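import Summits.ABC.IUTFork.Conditional.FreyHullThresholdGenuineWild
import Summits.ABC.IUTFork.Conditional.AbcOfSGenuineKChosenDepthRadRows3
import Summits.ABC.IUTFork.Conditional.AbcOfSGenuineKLinUniformRows3
import Summits.ABC.IUTFork.Conditional.AbcOfSGenuineKTameRobustRows5
import Summits.ABC.IUTFork.Repair.CandInternal2RealGapRows
import HarnessLib

/-!
# R-W table rows «REFUTED at pinned types only» DECIDED on the refuted side WITHOUT a pinned type: the 28 Frey (datum, l) of
# `REFUTED-CERTS-PENDING-CLASS.tsv` set (A), at the wild pole `p = 3`, by the `δ`-cell engine at every member of the local-type class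

PROOF-ONLY file (no `def`, no new `Prop`, no instance) of the abc-iut cell (rung LADDER-ABC:A2.RESCUE.W, lane P−; seat abc-iut-w4-d094 gen 8, row
«W:FREY-PINNED-28»). TAKES NO SIDE on [IUTchIII] Cor. 3.12 or on any author. Three known abc triples (the tree's `IsABCTriple` lemmas BY NAME):
`7³29⁵151² + 2⁴5¹⁶·97·919 = 3²⁷13⁴` (`l = 29` and the 25 tabulated primes `251 ≤ l ≤ 397`; `t = 27`, class `A ∈ {10, 30}`),
`71⁸233³ + 2⁵5¹⁸7³17³·981439 = 3³⁸13⁴·5233` (`l = 71` — the `l = p` exception of the [LIN] band p-id of record; `t = 38`, class `{30}`),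
`2¹²13³223³ + 3¹⁵11³97⁵409 = 5¹⁵179⁴2141` (`l = 97`; `t = 15`, class `{2, 6}`). For each: a CELL TABLE (`WildCells.…`: at every tabulated `l` and
every class member the `δ`-cell fails at the top label — closed numerals by `norm_num`, the R-W numerics lead's margins e.g. `−28025 / −58845` at
`l = 29`, `−748542` at `l = 71`, `−19249 / −1293` at `l = 97`) and ONE row theorem `GenuineK.not_pilotKummerCompatHull_chosen_frey<a>_wild (hl : l ∈ […])`
through the engine `GenuineK.not_pilotKummerCompatHull_chosen_triple_of_wildCells` (`Conditional/FreyHullThresholdGenuineWild`): for EVERY genuine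
Θ-volume datum `T` over `(ratPoint (a/c), l)` the hull-level clause S_H (chosen realising ideles, pinned reading — the per-datum object of the window
binders `hSHw`/`hSHwBad`) FAILS for every choice of the free context binders and Kummer datum. The local type at `3` is NOT pinned and NOT assumed:
`e(K_{x₀}/ℚ₃) = A·l` with `A` in the class BY THEOREM (`GenuineK.ramificationIdx_F_wild_class_ratPoint`), the different by DEDEKIND
(`differentOrd_rescaledCompletion_le_dedekind`). NOT claimed: admissibility / Szpiro-badness / (P6) of `(ratPoint (a/c), l)`, non-emptiness of
the datum type. HONEST SCOPE as in the parents: SHARP reading; per-label licence STRONGER than print; «refuted as typed» ≠ «refuted in print»;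
nothing about the number-level Corollary; typed ≠ proved; instantiated ≠ endorsed.
[cite: Mochizuki2012, IUTchIII Cor. 3.12 Step (xi-f) p. 184; IUTchIV Prop. 1.2 p. 10, Cor. 2.2 (ii) proof p. 44] [cite: NeukirchANT1999, Ch. III (2.6)]
[claim: Mochizuki2012, status: disputed] for every IUT sentence quoted.
-/

noncomputable section

open Set Function NumberField IsDedekindDomain

namespace Summit.ABC.IUTFork.Conditional

open Thm311 Thm311.Real Cor312 Cor312Vol Cor312Prov Literature.IUT.LogThetaLattice Literature.IUT.LogVolume
  Literature.IUT.HodgeTheaters Literature.IUT.LogVolume.ThetaData Literature.IUT.LogVolume.Cor22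
open Literature.NumberTheory.NumberFields Literature.NumberTheory.GaloisRepresentations.Ultrametric
open Literature.NumberTheory.DiophantineGeometry Literature.NumberTheory.DiophantineGeometry.GenEll Summit.ABC.ABC.Theorems

/-! ## §1. Cell tables -/

/-- **CELL TABLE `7³29⁵151² + 2⁴5¹⁶·97·919 = 3²⁷13⁴` (`p = 3`, `t = v₃(abc) = 27`)**: for every tabulated `l` and EVERY member `A` of the local-type class
(`2 ∣ A`, `15 ∣ A·27`, `A ∣ 30`, `5 ∣ 27 ⇒ A ∣ 6` — here `A ∈ {10, 30}`) the `δ`-cell of the engine FAILS at the top label `j = (l−1)/2` with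
`e = A·l`, `P_q = 27·A`, `r_in = ⌊e/2⌋ + 1`, `r_out = 3^{a₀} − a₀·e` (turning point `a₀`), `δ = e − 1 + [3 ∣ A]·e` (Dedekind). Pure numerals
(`eq_of_dvd_thirty`, `interval_cases`, `norm_num`); the R-W numerics lead's `REFUTED-CERTS-PENDING-CLASS.tsv` margins cell for cell. [folklore] -/
theorem WildCells.frey160412424963707 : ∀ l ∈ ([29, 251, 257, 263, 269, 271, 277, 281, 283, 293, 307, 311, 313, 317, 331, 337, 347, 349, 353, 359, 367, 373, 379, 383, 389, 397] : List ℕ), ∀ A : ℕ, ((3 : ℕ) - 1) ∣ A → 15 ∣ A * 27 → A ∣ (3 : ℕ) * ((3 : ℕ) - 1) * 5 →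
      (5 ∣ 27 → A ∣ (3 : ℕ) * ((3 : ℕ) - 1)) →
      ∃ a₀ : ℕ, (∀ a, a < a₀ → (1 : ℤ) * ((3 : ℕ) : ℤ) ^ a * (((3 : ℕ) : ℤ) - 1) < ((A * l : ℕ) : ℤ)) ∧
        ((A * l : ℕ) : ℤ) ≤ 1 * ((3 : ℕ) : ℤ) ^ a₀ * (((3 : ℕ) : ℤ) - 1) ∧
        ((A * 27 : ℕ) : ℤ) - (((((l - 1) / 2 - 1 : ℕ) : ℕ) : ℤ) + 1 + 1) * (((3 : ℕ) : ℤ) ^ a₀ - (a₀ : ℤ) * ((A * l : ℕ) : ℤ)) <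
          ((A * l : ℕ) : ℤ) * (((((((l - 1) / 2 - 1 : ℕ) : ℕ) : ℤ) + 1) ^ 2 * ((A * 27 : ℕ) : ℤ)
            - (((((l - 1) / 2 - 1 : ℕ) : ℕ) : ℤ) + 1) * (((A * l - 1 + (if (3 : ℕ) ∣ A then A * l else 0) : ℕ) : ℤ))
            - (((((l - 1) / 2 - 1 : ℕ) : ℕ) : ℤ) + 1 + 1) * (((A * l) / ((3 : ℕ) - 1) + 1 : ℕ) : ℤ)) / ((A * l : ℕ) : ℤ)) := by
  intro l hl A h2 h15 h30 h6
  simp only [List.mem_cons, List.not_mem_nil, or_false] at hl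
  rcases hl with rfl | rfl | rfl | rfl | rfl | rfl | rfl | rfl | rfl | rfl | rfl | rfl | rfl | rfl | rfl | rfl | rfl | rfl | rfl | rfl | rfl | rfl | rfl | rfl | rfl | rfl
  all_goals
    rcases Summit.ABC.IUTFork.Repair.CandInternal2RealGapRows.eq_of_dvd_thirty h30 with rfl | rfl | rfl | rfl | rfl | rfl | rfl | rfl
    all_goals
      first
      | omega
      | (refine ⟨5, ?_, ?_, ?_⟩ <;>
          [(intro a ha; interval_cases a <;> (norm_num; done)); (norm_num; done); (norm_num; done)])
      | (refine ⟨7, ?_, ?_, ?_⟩ <;>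
          [(intro a ha; interval_cases a <;> (norm_num; done)); (norm_num; done); (norm_num; done)])
      | (refine ⟨6, ?_, ?_, ?_⟩ <;>
          [(intro a ha; interval_cases a <;> (norm_num; done)); (norm_num; done); (norm_num; done)])
      | (refine ⟨8, ?_, ?_, ?_⟩ <;>
          [(intro a ha; interval_cases a <;> (norm_num; done)); (norm_num; done); (norm_num; done)])

/-- **CELL TABLE `71⁸233³ + 2⁵5¹⁸7³17³·981439 = 3³⁸13⁴·5233` (`p = 3`, `t = v₃(abc) = 38`)**: for every tabulated `l` and EVERY member `A` of the local-type class
(`2 ∣ A`, `15 ∣ A·38`, `A ∣ 30`, `5 ∣ 38 ⇒ A ∣ 6` — here `A ∈ {30}`) the `δ`-cell of the engine FAILS at the top label `j = (l−1)/2` with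
`e = A·l`, `P_q = 38·A`, `r_in = ⌊e/2⌋ + 1`, `r_out = 3^{a₀} − a₀·e` (turning point `a₀`), `δ = e − 1 + [3 ∣ A]·e` (Dedekind). Pure numerals
(`eq_of_dvd_thirty`, `interval_cases`, `norm_num`); the R-W numerics lead's `REFUTED-CERTS-PENDING-CLASS.tsv` margins cell for cell. [folklore] -/
theorem WildCells.frey8168354035667660710457 : ∀ l ∈ ([71] : List ℕ), ∀ A : ℕ, ((3 : ℕ) - 1) ∣ A → 15 ∣ A * 38 → A ∣ (3 : ℕ) * ((3 : ℕ) - 1) * 5 →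
      (5 ∣ 38 → A ∣ (3 : ℕ) * ((3 : ℕ) - 1)) →
      ∃ a₀ : ℕ, (∀ a, a < a₀ → (1 : ℤ) * ((3 : ℕ) : ℤ) ^ a * (((3 : ℕ) : ℤ) - 1) < ((A * l : ℕ) : ℤ)) ∧
        ((A * l : ℕ) : ℤ) ≤ 1 * ((3 : ℕ) : ℤ) ^ a₀ * (((3 : ℕ) : ℤ) - 1) ∧
        ((A * 38 : ℕ) : ℤ) - (((((l - 1) / 2 - 1 : ℕ) : ℕ) : ℤ) + 1 + 1) * (((3 : ℕ) : ℤ) ^ a₀ - (a₀ : ℤ) * ((A * l : ℕ) : ℤ)) <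
          ((A * l : ℕ) : ℤ) * (((((((l - 1) / 2 - 1 : ℕ) : ℕ) : ℤ) + 1) ^ 2 * ((A * 38 : ℕ) : ℤ)
            - (((((l - 1) / 2 - 1 : ℕ) : ℕ) : ℤ) + 1) * (((A * l - 1 + (if (3 : ℕ) ∣ A then A * l else 0) : ℕ) : ℤ))
            - (((((l - 1) / 2 - 1 : ℕ) : ℕ) : ℤ) + 1 + 1) * (((A * l) / ((3 : ℕ) - 1) + 1 : ℕ) : ℤ)) / ((A * l : ℕ) : ℤ)) := by
  intro l hl A h2 h15 h30 h6
  simp only [List.mem_cons, List.not_mem_nil, or_false] at hl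
  subst hl
  rcases Summit.ABC.IUTFork.Repair.CandInternal2RealGapRows.eq_of_dvd_thirty h30 with rfl | rfl | rfl | rfl | rfl | rfl | rfl | rfl
  all_goals
    first
    | omega
    | (refine ⟨7, ?_, ?_, ?_⟩ <;>
          [(intro a ha; interval_cases a <;> (norm_num; done)); (norm_num; done); (norm_num; done)])

/-- **CELL TABLE `2¹²13³223³ + 3¹⁵11³97⁵409 = 5¹⁵179⁴2141` (`p = 3`, `t = v₃(abc) = 15`)**: for every tabulated `l` and EVERY member `A` of the local-type class
(`2 ∣ A`, `15 ∣ A·15`, `A ∣ 30`, `5 ∣ 15 ⇒ A ∣ 6` — here `A ∈ {2, 6}`) the `δ`-cell of the engine FAILS at the top label `j = (l−1)/2` with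
`e = A·l`, `P_q = 15·A`, `r_in = ⌊e/2⌋ + 1`, `r_out = 3^{a₀} − a₀·e` (turning point `a₀`), `δ = e − 1 + [3 ∣ A]·e` (Dedekind). Pure numerals
(`eq_of_dvd_thirty`, `interval_cases`, `norm_num`); the R-W numerics lead's `REFUTED-CERTS-PENDING-CLASS.tsv` margins cell for cell. [folklore] -/
theorem WildCells.frey99794037551104 : ∀ l ∈ ([97] : List ℕ), ∀ A : ℕ, ((3 : ℕ) - 1) ∣ A → 15 ∣ A * 15 → A ∣ (3 : ℕ) * ((3 : ℕ) - 1) * 5 →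
      (5 ∣ 15 → A ∣ (3 : ℕ) * ((3 : ℕ) - 1)) →
      ∃ a₀ : ℕ, (∀ a, a < a₀ → (1 : ℤ) * ((3 : ℕ) : ℤ) ^ a * (((3 : ℕ) : ℤ) - 1) < ((A * l : ℕ) : ℤ)) ∧
        ((A * l : ℕ) : ℤ) ≤ 1 * ((3 : ℕ) : ℤ) ^ a₀ * (((3 : ℕ) : ℤ) - 1) ∧
        ((A * 15 : ℕ) : ℤ) - (((((l - 1) / 2 - 1 : ℕ) : ℕ) : ℤ) + 1 + 1) * (((3 : ℕ) : ℤ) ^ a₀ - (a₀ : ℤ) * ((A * l : ℕ) : ℤ)) <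
          ((A * l : ℕ) : ℤ) * (((((((l - 1) / 2 - 1 : ℕ) : ℕ) : ℤ) + 1) ^ 2 * ((A * 15 : ℕ) : ℤ)
            - (((((l - 1) / 2 - 1 : ℕ) : ℕ) : ℤ) + 1) * (((A * l - 1 + (if (3 : ℕ) ∣ A then A * l else 0) : ℕ) : ℤ))
            - (((((l - 1) / 2 - 1 : ℕ) : ℕ) : ℤ) + 1 + 1) * (((A * l) / ((3 : ℕ) - 1) + 1 : ℕ) : ℤ)) / ((A * l : ℕ) : ℤ)) := by
  intro l hl A h2 h15 h30 h6
  simp only [List.mem_cons, List.not_mem_nil, or_false] at hl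
  subst hl
  rcases Summit.ABC.IUTFork.Repair.CandInternal2RealGapRows.eq_of_dvd_thirty h30 with rfl | rfl | rfl | rfl | rfl | rfl | rfl | rfl
  all_goals
    first
    | omega
    | (refine ⟨5, ?_, ?_, ?_⟩ <;>
          [(intro a ha; interval_cases a <;> (norm_num; done)); (norm_num; done); (norm_num; done)])
    | (refine ⟨6, ?_, ?_, ?_⟩ <;>
          [(intro a ha; interval_cases a <;> (norm_num; done)); (norm_num; done); (norm_num; done)])

/-! ## §2. The rows: S_H FAILS at every genuine datum over the 28 (datum, l) -/

/-- **R-W ROWS `pilotDataOfK:frey-160412424963707-…:l`, l ∈ {29, 251, 257, 263, 269, 271, 277, 281, 283, 293, 307, 311, 313, 317, 331, 337, 347, 349, 353, 359, 367, 373, 379, 383, 389, 397} — REFUTED side, UNCONDITIONALLY, at the WILD pole `p = 3`**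
(`7 ^ 3 * 29 ^ 5 * 151 ^ 2 + 2 ^ 4 * 5 ^ 16 * 97 * 919 = 3 ^ 27 * 13 ^ 4`, `v₃(abc) = 27`; the R-W numerics lead's «refuted at pinned types only» rows of `REFUTED-CERTS-PENDING-CLASS.tsv`): for EVERY
genuine Θ-volume datum `T` over `(ratPoint (a/c), l)` and EVERY choice of the free context binders and Kummer data, the hull-level clause S_H
(`Cor312Vol.PilotKummerCompatHull`, chosen realising ideles, pinned reading) FAILS — engine `GenuineK.not_pilotKummerCompatHull_chosen_triple_of_wildCells`
at the top label with the cell table `WildCells.frey160412424963707`; local-type class `A ∈ {10, 30}` BY THEOREM (no pinned type, no local hypothesis).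
NOT claimed: admissibility / Szpiro-badness / (P6) of `(ratPoint (a/c), l)`, non-emptiness of the datum type; refuted-as-typed ≠ refuted-in-print.
[cite: Mochizuki2012, IUTchIII Cor. 3.12 Step (xi-f) p. 184; IUTchIV Prop. 1.2 (i)(ii) p. 10] [claim: Mochizuki2012, status: disputed] -/
theorem GenuineK.not_pilotKummerCompatHull_chosen_frey160412424963707_wild {l : ℕ} (hl : l ∈ ([29, 251, 257, 263, 269, 271, 277, 281, 283, 293, 307, 311, 313, 317, 331, 337, 347, 349, 353, 359, 367, 373, 379, 383, 389, 397] : List ℕ))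
    (T : Cor22.ThetaVolumeDatumAt (ratPoint (((7 ^ 3 * 29 ^ 5 * 151 ^ 2 : ℕ) : ℚ) / (3 ^ 27 * 13 ^ 4 : ℕ))) l) :
    letI := T.instFieldF; letI := T.instNumberFieldF; letI := T.instAlgebraF; letI := T.instFieldK
    letI := T.instNumberFieldK; letI := T.instAlgebraK; letI := T.instFieldFbar; letI := T.instAlgebraFbar
    letI := T.instAlgebraKFbar; letI := T.instIsElliptic
    ∀ (M : Type) [Field M] [NumberField M]
      (archPk : ∀ (j : (thetaIndex (pilotDataOfK T.D T.K)).Label) (vQ : (thetaIndex (pilotDataOfK T.D T.K)).VQ),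
        Set ((logShellsDH (pilotDataOfK T.D T.K) (analyticLogv T.K)).Packet j vQ))
      (archSub : ∀ (j : (thetaIndex (pilotDataOfK T.D T.K)).Label) (v : (thetaIndex (pilotDataOfK T.D T.K)).V),
        Set ((logShellsDH (pilotDataOfK T.D T.K) (analyticLogv T.K)).Packet j ((thetaIndex (pilotDataOfK T.D T.K)).over v)))
      (Ψ : ℤ → ∀ v : (thetaIndex (pilotDataOfK T.D T.K)).V, v ∈ (thetaIndex (pilotDataOfK T.D T.K)).Vbad →
        Set ((logShellsDH (pilotDataOfK T.D T.K) (analyticLogv T.K)).StarPacket v))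
      (act : ℤ → ∀ v : (thetaIndex (pilotDataOfK T.D T.K)).V, v ∈ (thetaIndex (pilotDataOfK T.D T.K)).Vbad →
        (logShellsDH (pilotDataOfK T.D T.K) (analyticLogv T.K)).StarPacket v →
          Module.End ℚ ((logShellsDH (pilotDataOfK T.D T.K) (analyticLogv T.K)).StarPacket v))
      (Mmod : ℤ → ∀ j : (thetaIndex (pilotDataOfK T.D T.K)).LabelStar,
        Set ((logShellsDH (pilotDataOfK T.D T.K) (analyticLogv T.K)).GlobalPacket j.1))
      (region : ℤ → ∀ j : (thetaIndex (pilotDataOfK T.D T.K)).LabelStar, FinDivisor M →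
        ∀ vQ : (thetaIndex (pilotDataOfK T.D T.K)).VQ, Set ((logShellsDH (pilotDataOfK T.D T.K) (analyticLogv T.K)).Packet j.1 vQ))
      (frobAdm : ℤ → ℤ → ∀ (j : (thetaIndex (pilotDataOfK T.D T.K)).Label) (vQ : (thetaIndex (pilotDataOfK T.D T.K)).VQ),
        Set ((logShellsDH (pilotDataOfK T.D T.K) (analyticLogv T.K)).Packet j vQ) → Prop)
      (frobLogvol : ℤ → ℤ → ∀ (j : (thetaIndex (pilotDataOfK T.D T.K)).Label) (vQ : (thetaIndex (pilotDataOfK T.D T.K)).VQ),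
        Set ((logShellsDH (pilotDataOfK T.D T.K) (analyticLogv T.K)).Packet j vQ) → ℝ)
      (frobΨ : ℤ → ℤ → ∀ v : (thetaIndex (pilotDataOfK T.D T.K)).V, v ∈ (thetaIndex (pilotDataOfK T.D T.K)).Vbad →
        Set ((logShellsDH (pilotDataOfK T.D T.K) (analyticLogv T.K)).StarPacket v))
      (frobMmod : ℤ → ℤ → ∀ j : (thetaIndex (pilotDataOfK T.D T.K)).LabelStar,
        Set ((logShellsDH (pilotDataOfK T.D T.K) (analyticLogv T.K)).GlobalPacket j.1))
      (unitImage : ℤ → ℤ → ℕ → ∀ (j : (thetaIndex (pilotDataOfK T.D T.K)).Label) (vQ : (thetaIndex (pilotDataOfK T.D T.K)).VQ),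
        Set ((logShellsDH (pilotDataOfK T.D T.K) (analyticLogv T.K)).Packet j vQ))
      (ballImage : ℤ → ℤ → ∀ (j : (thetaIndex (pilotDataOfK T.D T.K)).Label) (vQ : (thetaIndex (pilotDataOfK T.D T.K)).VQ),
        Set ((logShellsDH (pilotDataOfK T.D T.K) (analyticLogv T.K)).Packet j vQ))
      (thetaDiv : ℤ → ℤ → LgpDivisor M (thetaIndex (pilotDataOfK T.D T.K)).lstar)
      (n : ℤ) {HT : Type} {LogLink : HT → HT → Type} {IsFull : ∀ {s t : HT}, LogLink s t → Prop}
      (lat : LGPGaussianLogThetaLattice LogLink IsFull)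
      {Frd : Type} {IsoF : Frd → Frd → Type} {Ob : Frd → Type} {realify : Frd → Frd} {Strip : Type}
      {IsoS : Strip → Strip → Type} {Mv : ∀ v : (thetaIndex (pilotDataOfK T.D T.K)).V, v ∈ (thetaIndex (pilotDataOfK T.D T.K)).Vbad → Type}
      [∀ v h, Monoid (Mv v h)]
      (sig : GlobalLGPFrobenioidSignature (thetaIndex (pilotDataOfK T.D T.K)).lstar (thetaIndex (pilotDataOfK T.D T.K)).V
        (· ∈ (thetaIndex (pilotDataOfK T.D T.K)).Vbad) Frd IsoF Ob realify Strip IsoS Mv)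
      (split : SplittingMonoids Mv) {ObΔ : Type}
      {N : ∀ v : (thetaIndex (pilotDataOfK T.D T.K)).V, v ∈ (thetaIndex (pilotDataOfK T.D T.K)).Vbad → Type}
      [∀ v h, Monoid (N v h)] (qData : QPilotData ObΔ N)
      (qK : ∀ v : (thetaIndex (pilotDataOfK T.D T.K)).V, v ∈ (thetaIndex (pilotDataOfK T.D T.K)).Vbad →
        Set ((logShellsDH (pilotDataOfK T.D T.K) (analyticLogv T.K)).StarPacket v)),
    ¬ Cor312Vol.PilotKummerCompatHull
        (LatticeSituation.ofShells (logShellsDH (pilotDataOfK T.D T.K) (analyticLogv T.K)) M archPk archSub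
          (summandPiecesPr (pilotDataOfK T.D T.K) (logvAnalytic_analyticLogv (F := T.K))).Adm
          (summandPiecesPr (pilotDataOfK T.D T.K) (logvAnalytic_analyticLogv (F := T.K))).logvol Ψ act Mmod region frobAdm
          frobLogvol frobΨ frobMmod unitImage ballImage thetaDiv)
        (settingPrVolSharp (pilotDataOfK T.D T.K) (logvAnalytic_analyticLogv (F := T.K)) M archPk archSub Ψ act Mmod region n
          lat sig split qData (exists_realising_qIdeles_pilotDataOfK T.D).choose (exists_realising_thetaIdeles_pilotDataOfK T.D).choose
          (exists_realising_qIdeles_pilotDataOfK T.D).choose_spec.1 (exists_realising_qIdeles_pilotDataOfK T.D).choose_spec.2.1)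
        (fun _ => Cor312.Setting.qRegion
          (settingPrVolSharp (pilotDataOfK T.D T.K) (logvAnalytic_analyticLogv (F := T.K)) M archPk archSub Ψ act Mmod region n
            lat sig split qData (exists_realising_qIdeles_pilotDataOfK T.D).choose (exists_realising_thetaIdeles_pilotDataOfK T.D).choose
            (exists_realising_qIdeles_pilotDataOfK T.D).choose_spec.1 (exists_realising_qIdeles_pilotDataOfK T.D).choose_spec.2.1))
        qK := by
  have hcells := WildCells.frey160412424963707 l hl
  have hl3 : (3 : ℕ) ≠ l ∧ 3 ≤ l := by
    simp only [List.mem_cons, List.not_mem_nil, or_false] at hl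
    rcases hl with rfl | rfl | rfl | rfl | rfl | rfl | rfl | rfl | rfl | rfl | rfl | rfl | rfl | rfl | rfl | rfl | rfl | rfl | rfl | rfl | rfl | rfl | rfl | rfl | rfl | rfl <;> norm_num
  exact GenuineK.not_pilotKummerCompatHull_chosen_triple_of_wildCells (b := 2 ^ 4 * 5 ^ 16 * 97 * 919) isABCTriple_frey160412424963707 T ⟨3, by norm_num⟩ (p' := 5)
    (Or.inl ⟨rfl, rfl⟩) hl3.1 (t := 27) (by norm_num) (by norm_num) (by norm_num) (i := (l - 1) / 2 - 1) (by omega) hcells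

/-- **R-W ROWS `pilotDataOfK:frey-8168354035667660710457-…:l`, l = 71 — REFUTED side, UNCONDITIONALLY, at the WILD pole `p = 3`**
(`71 ^ 8 * 233 ^ 3 + 2 ^ 5 * 5 ^ 18 * 7 ^ 3 * 17 ^ 3 * 981439 = 3 ^ 38 * 13 ^ 4 * 5233`, `v₃(abc) = 38`; the R-W numerics lead's «refuted at pinned types only» rows of `REFUTED-CERTS-PENDING-CLASS.tsv`): for EVERY
genuine Θ-volume datum `T` over `(ratPoint (a/c), l)` and EVERY choice of the free context binders and Kummer data, the hull-level clause S_H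
(`Cor312Vol.PilotKummerCompatHull`, chosen realising ideles, pinned reading) FAILS — engine `GenuineK.not_pilotKummerCompatHull_chosen_triple_of_wildCells`
at the top label with the cell table `WildCells.frey8168354035667660710457`; local-type class `A ∈ {30}` BY THEOREM (no pinned type, no local hypothesis).
NOT claimed: admissibility / Szpiro-badness / (P6) of `(ratPoint (a/c), l)`, non-emptiness of the datum type; refuted-as-typed ≠ refuted-in-print.
[cite: Mochizuki2012, IUTchIII Cor. 3.12 Step (xi-f) p. 184; IUTchIV Prop. 1.2 (i)(ii) p. 10] [claim: Mochizuki2012, status: disputed] -/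
theorem GenuineK.not_pilotKummerCompatHull_chosen_frey8168354035667660710457_wild {l : ℕ} (hl : l ∈ ([71] : List ℕ))
    (T : Cor22.ThetaVolumeDatumAt (ratPoint (((71 ^ 8 * 233 ^ 3 : ℕ) : ℚ) / (3 ^ 38 * 13 ^ 4 * 5233 : ℕ))) l) :
    letI := T.instFieldF; letI := T.instNumberFieldF; letI := T.instAlgebraF; letI := T.instFieldK
    letI := T.instNumberFieldK; letI := T.instAlgebraK; letI := T.instFieldFbar; letI := T.instAlgebraFbar
    letI := T.instAlgebraKFbar; letI := T.instIsElliptic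
    ∀ (M : Type) [Field M] [NumberField M]
      (archPk : ∀ (j : (thetaIndex (pilotDataOfK T.D T.K)).Label) (vQ : (thetaIndex (pilotDataOfK T.D T.K)).VQ),
        Set ((logShellsDH (pilotDataOfK T.D T.K) (analyticLogv T.K)).Packet j vQ))
      (archSub : ∀ (j : (thetaIndex (pilotDataOfK T.D T.K)).Label) (v : (thetaIndex (pilotDataOfK T.D T.K)).V),
        Set ((logShellsDH (pilotDataOfK T.D T.K) (analyticLogv T.K)).Packet j ((thetaIndex (pilotDataOfK T.D T.K)).over v)))
      (Ψ : ℤ → ∀ v : (thetaIndex (pilotDataOfK T.D T.K)).V, v ∈ (thetaIndex (pilotDataOfK T.D T.K)).Vbad →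
        Set ((logShellsDH (pilotDataOfK T.D T.K) (analyticLogv T.K)).StarPacket v))
      (act : ℤ → ∀ v : (thetaIndex (pilotDataOfK T.D T.K)).V, v ∈ (thetaIndex (pilotDataOfK T.D T.K)).Vbad →
        (logShellsDH (pilotDataOfK T.D T.K) (analyticLogv T.K)).StarPacket v →
          Module.End ℚ ((logShellsDH (pilotDataOfK T.D T.K) (analyticLogv T.K)).StarPacket v))
      (Mmod : ℤ → ∀ j : (thetaIndex (pilotDataOfK T.D T.K)).LabelStar,
        Set ((logShellsDH (pilotDataOfK T.D T.K) (analyticLogv T.K)).GlobalPacket j.1))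
      (region : ℤ → ∀ j : (thetaIndex (pilotDataOfK T.D T.K)).LabelStar, FinDivisor M →
        ∀ vQ : (thetaIndex (pilotDataOfK T.D T.K)).VQ, Set ((logShellsDH (pilotDataOfK T.D T.K) (analyticLogv T.K)).Packet j.1 vQ))
      (frobAdm : ℤ → ℤ → ∀ (j : (thetaIndex (pilotDataOfK T.D T.K)).Label) (vQ : (thetaIndex (pilotDataOfK T.D T.K)).VQ),
        Set ((logShellsDH (pilotDataOfK T.D T.K) (analyticLogv T.K)).Packet j vQ) → Prop)
      (frobLogvol : ℤ → ℤ → ∀ (j : (thetaIndex (pilotDataOfK T.D T.K)).Label) (vQ : (thetaIndex (pilotDataOfK T.D T.K)).VQ),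
        Set ((logShellsDH (pilotDataOfK T.D T.K) (analyticLogv T.K)).Packet j vQ) → ℝ)
      (frobΨ : ℤ → ℤ → ∀ v : (thetaIndex (pilotDataOfK T.D T.K)).V, v ∈ (thetaIndex (pilotDataOfK T.D T.K)).Vbad →
        Set ((logShellsDH (pilotDataOfK T.D T.K) (analyticLogv T.K)).StarPacket v))
      (frobMmod : ℤ → ℤ → ∀ j : (thetaIndex (pilotDataOfK T.D T.K)).LabelStar,
        Set ((logShellsDH (pilotDataOfK T.D T.K) (analyticLogv T.K)).GlobalPacket j.1))
      (unitImage : ℤ → ℤ → ℕ → ∀ (j : (thetaIndex (pilotDataOfK T.D T.K)).Label) (vQ : (thetaIndex (pilotDataOfK T.D T.K)).VQ),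
        Set ((logShellsDH (pilotDataOfK T.D T.K) (analyticLogv T.K)).Packet j vQ))
      (ballImage : ℤ → ℤ → ∀ (j : (thetaIndex (pilotDataOfK T.D T.K)).Label) (vQ : (thetaIndex (pilotDataOfK T.D T.K)).VQ),
        Set ((logShellsDH (pilotDataOfK T.D T.K) (analyticLogv T.K)).Packet j vQ))
      (thetaDiv : ℤ → ℤ → LgpDivisor M (thetaIndex (pilotDataOfK T.D T.K)).lstar)
      (n : ℤ) {HT : Type} {LogLink : HT → HT → Type} {IsFull : ∀ {s t : HT}, LogLink s t → Prop}
      (lat : LGPGaussianLogThetaLattice LogLink IsFull)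
      {Frd : Type} {IsoF : Frd → Frd → Type} {Ob : Frd → Type} {realify : Frd → Frd} {Strip : Type}
      {IsoS : Strip → Strip → Type} {Mv : ∀ v : (thetaIndex (pilotDataOfK T.D T.K)).V, v ∈ (thetaIndex (pilotDataOfK T.D T.K)).Vbad → Type}
      [∀ v h, Monoid (Mv v h)]
      (sig : GlobalLGPFrobenioidSignature (thetaIndex (pilotDataOfK T.D T.K)).lstar (thetaIndex (pilotDataOfK T.D T.K)).V
        (· ∈ (thetaIndex (pilotDataOfK T.D T.K)).Vbad) Frd IsoF Ob realify Strip IsoS Mv)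
      (split : SplittingMonoids Mv) {ObΔ : Type}
      {N : ∀ v : (thetaIndex (pilotDataOfK T.D T.K)).V, v ∈ (thetaIndex (pilotDataOfK T.D T.K)).Vbad → Type}
      [∀ v h, Monoid (N v h)] (qData : QPilotData ObΔ N)
      (qK : ∀ v : (thetaIndex (pilotDataOfK T.D T.K)).V, v ∈ (thetaIndex (pilotDataOfK T.D T.K)).Vbad →
        Set ((logShellsDH (pilotDataOfK T.D T.K) (analyticLogv T.K)).StarPacket v)),
    ¬ Cor312Vol.PilotKummerCompatHull
        (LatticeSituation.ofShells (logShellsDH (pilotDataOfK T.D T.K) (analyticLogv T.K)) M archPk archSub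
          (summandPiecesPr (pilotDataOfK T.D T.K) (logvAnalytic_analyticLogv (F := T.K))).Adm
          (summandPiecesPr (pilotDataOfK T.D T.K) (logvAnalytic_analyticLogv (F := T.K))).logvol Ψ act Mmod region frobAdm
          frobLogvol frobΨ frobMmod unitImage ballImage thetaDiv)
        (settingPrVolSharp (pilotDataOfK T.D T.K) (logvAnalytic_analyticLogv (F := T.K)) M archPk archSub Ψ act Mmod region n
          lat sig split qData (exists_realising_qIdeles_pilotDataOfK T.D).choose (exists_realising_thetaIdeles_pilotDataOfK T.D).choose
          (exists_realising_qIdeles_pilotDataOfK T.D).choose_spec.1 (exists_realising_qIdeles_pilotDataOfK T.D).choose_spec.2.1)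
        (fun _ => Cor312.Setting.qRegion
          (settingPrVolSharp (pilotDataOfK T.D T.K) (logvAnalytic_analyticLogv (F := T.K)) M archPk archSub Ψ act Mmod region n
            lat sig split qData (exists_realising_qIdeles_pilotDataOfK T.D).choose (exists_realising_thetaIdeles_pilotDataOfK T.D).choose
            (exists_realising_qIdeles_pilotDataOfK T.D).choose_spec.1 (exists_realising_qIdeles_pilotDataOfK T.D).choose_spec.2.1))
        qK := by
  have hcells := WildCells.frey8168354035667660710457 l hl
  have hl3 : (3 : ℕ) ≠ l ∧ 3 ≤ l := by
    simp only [List.mem_cons, List.not_mem_nil, or_false] at hl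
    rcases hl with rfl; norm_num
  exact GenuineK.not_pilotKummerCompatHull_chosen_triple_of_wildCells (b := 2 ^ 5 * 5 ^ 18 * 7 ^ 3 * 17 ^ 3 * 981439) isABCTriple_frey8168354035667660710457 T ⟨3, by norm_num⟩ (p' := 5)
    (Or.inl ⟨rfl, rfl⟩) hl3.1 (t := 38) (by norm_num) (by norm_num) (by norm_num) (i := (l - 1) / 2 - 1) (by omega) hcells

/-- **R-W ROWS `pilotDataOfK:frey-99794037551104-…:l`, l = 97 — REFUTED side, UNCONDITIONALLY, at the WILD pole `p = 3`**
(`2 ^ 12 * 13 ^ 3 * 223 ^ 3 + 3 ^ 15 * 11 ^ 3 * 97 ^ 5 * 409 = 5 ^ 15 * 179 ^ 4 * 2141`, `v₃(abc) = 15`; the R-W numerics lead's «refuted at pinned types only» rows of `REFUTED-CERTS-PENDING-CLASS.tsv`): for EVERY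
genuine Θ-volume datum `T` over `(ratPoint (a/c), l)` and EVERY choice of the free context binders and Kummer data, the hull-level clause S_H
(`Cor312Vol.PilotKummerCompatHull`, chosen realising ideles, pinned reading) FAILS — engine `GenuineK.not_pilotKummerCompatHull_chosen_triple_of_wildCells`
at the top label with the cell table `WildCells.frey99794037551104`; local-type class `A ∈ {2, 6}` BY THEOREM (no pinned type, no local hypothesis).
NOT claimed: admissibility / Szpiro-badness / (P6) of `(ratPoint (a/c), l)`, non-emptiness of the datum type; refuted-as-typed ≠ refuted-in-print.
[cite: Mochizuki2012, IUTchIII Cor. 3.12 Step (xi-f) p. 184; IUTchIV Prop. 1.2 (i)(ii) p. 10] [claim: Mochizuki2012, status: disputed] -/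
theorem GenuineK.not_pilotKummerCompatHull_chosen_frey99794037551104_wild {l : ℕ} (hl : l ∈ ([97] : List ℕ))
    (T : Cor22.ThetaVolumeDatumAt (ratPoint (((2 ^ 12 * 13 ^ 3 * 223 ^ 3 : ℕ) : ℚ) / (5 ^ 15 * 179 ^ 4 * 2141 : ℕ))) l) :
    letI := T.instFieldF; letI := T.instNumberFieldF; letI := T.instAlgebraF; letI := T.instFieldK
    letI := T.instNumberFieldK; letI := T.instAlgebraK; letI := T.instFieldFbar; letI := T.instAlgebraFbar
    letI := T.instAlgebraKFbar; letI := T.instIsElliptic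
    ∀ (M : Type) [Field M] [NumberField M]
      (archPk : ∀ (j : (thetaIndex (pilotDataOfK T.D T.K)).Label) (vQ : (thetaIndex (pilotDataOfK T.D T.K)).VQ),
        Set ((logShellsDH (pilotDataOfK T.D T.K) (analyticLogv T.K)).Packet j vQ))
      (archSub : ∀ (j : (thetaIndex (pilotDataOfK T.D T.K)).Label) (v : (thetaIndex (pilotDataOfK T.D T.K)).V),
        Set ((logShellsDH (pilotDataOfK T.D T.K) (analyticLogv T.K)).Packet j ((thetaIndex (pilotDataOfK T.D T.K)).over v)))
      (Ψ : ℤ → ∀ v : (thetaIndex (pilotDataOfK T.D T.K)).V, v ∈ (thetaIndex (pilotDataOfK T.D T.K)).Vbad →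
        Set ((logShellsDH (pilotDataOfK T.D T.K) (analyticLogv T.K)).StarPacket v))
      (act : ℤ → ∀ v : (thetaIndex (pilotDataOfK T.D T.K)).V, v ∈ (thetaIndex (pilotDataOfK T.D T.K)).Vbad →
        (logShellsDH (pilotDataOfK T.D T.K) (analyticLogv T.K)).StarPacket v →
          Module.End ℚ ((logShellsDH (pilotDataOfK T.D T.K) (analyticLogv T.K)).StarPacket v))
      (Mmod : ℤ → ∀ j : (thetaIndex (pilotDataOfK T.D T.K)).LabelStar,
        Set ((logShellsDH (pilotDataOfK T.D T.K) (analyticLogv T.K)).GlobalPacket j.1))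
      (region : ℤ → ∀ j : (thetaIndex (pilotDataOfK T.D T.K)).LabelStar, FinDivisor M →
        ∀ vQ : (thetaIndex (pilotDataOfK T.D T.K)).VQ, Set ((logShellsDH (pilotDataOfK T.D T.K) (analyticLogv T.K)).Packet j.1 vQ))
      (frobAdm : ℤ → ℤ → ∀ (j : (thetaIndex (pilotDataOfK T.D T.K)).Label) (vQ : (thetaIndex (pilotDataOfK T.D T.K)).VQ),
        Set ((logShellsDH (pilotDataOfK T.D T.K) (analyticLogv T.K)).Packet j vQ) → Prop)
      (frobLogvol : ℤ → ℤ → ∀ (j : (thetaIndex (pilotDataOfK T.D T.K)).Label) (vQ : (thetaIndex (pilotDataOfK T.D T.K)).VQ),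
        Set ((logShellsDH (pilotDataOfK T.D T.K) (analyticLogv T.K)).Packet j vQ) → ℝ)
      (frobΨ : ℤ → ℤ → ∀ v : (thetaIndex (pilotDataOfK T.D T.K)).V, v ∈ (thetaIndex (pilotDataOfK T.D T.K)).Vbad →
        Set ((logShellsDH (pilotDataOfK T.D T.K) (analyticLogv T.K)).StarPacket v))
      (frobMmod : ℤ → ℤ → ∀ j : (thetaIndex (pilotDataOfK T.D T.K)).LabelStar,
        Set ((logShellsDH (pilotDataOfK T.D T.K) (analyticLogv T.K)).GlobalPacket j.1))
      (unitImage : ℤ → ℤ → ℕ → ∀ (j : (thetaIndex (pilotDataOfK T.D T.K)).Label) (vQ : (thetaIndex (pilotDataOfK T.D T.K)).VQ),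
        Set ((logShellsDH (pilotDataOfK T.D T.K) (analyticLogv T.K)).Packet j vQ))
      (ballImage : ℤ → ℤ → ∀ (j : (thetaIndex (pilotDataOfK T.D T.K)).Label) (vQ : (thetaIndex (pilotDataOfK T.D T.K)).VQ),
        Set ((logShellsDH (pilotDataOfK T.D T.K) (analyticLogv T.K)).Packet j vQ))
      (thetaDiv : ℤ → ℤ → LgpDivisor M (thetaIndex (pilotDataOfK T.D T.K)).lstar)
      (n : ℤ) {HT : Type} {LogLink : HT → HT → Type} {IsFull : ∀ {s t : HT}, LogLink s t → Prop}
      (lat : LGPGaussianLogThetaLattice LogLink IsFull)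
      {Frd : Type} {IsoF : Frd → Frd → Type} {Ob : Frd → Type} {realify : Frd → Frd} {Strip : Type}
      {IsoS : Strip → Strip → Type} {Mv : ∀ v : (thetaIndex (pilotDataOfK T.D T.K)).V, v ∈ (thetaIndex (pilotDataOfK T.D T.K)).Vbad → Type}
      [∀ v h, Monoid (Mv v h)]
      (sig : GlobalLGPFrobenioidSignature (thetaIndex (pilotDataOfK T.D T.K)).lstar (thetaIndex (pilotDataOfK T.D T.K)).V
        (· ∈ (thetaIndex (pilotDataOfK T.D T.K)).Vbad) Frd IsoF Ob realify Strip IsoS Mv)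
      (split : SplittingMonoids Mv) {ObΔ : Type}
      {N : ∀ v : (thetaIndex (pilotDataOfK T.D T.K)).V, v ∈ (thetaIndex (pilotDataOfK T.D T.K)).Vbad → Type}
      [∀ v h, Monoid (N v h)] (qData : QPilotData ObΔ N)
      (qK : ∀ v : (thetaIndex (pilotDataOfK T.D T.K)).V, v ∈ (thetaIndex (pilotDataOfK T.D T.K)).Vbad →
        Set ((logShellsDH (pilotDataOfK T.D T.K) (analyticLogv T.K)).StarPacket v)),
    ¬ Cor312Vol.PilotKummerCompatHull
        (LatticeSituation.ofShells (logShellsDH (pilotDataOfK T.D T.K) (analyticLogv T.K)) M archPk archSub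
          (summandPiecesPr (pilotDataOfK T.D T.K) (logvAnalytic_analyticLogv (F := T.K))).Adm
          (summandPiecesPr (pilotDataOfK T.D T.K) (logvAnalytic_analyticLogv (F := T.K))).logvol Ψ act Mmod region frobAdm
          frobLogvol frobΨ frobMmod unitImage ballImage thetaDiv)
        (settingPrVolSharp (pilotDataOfK T.D T.K) (logvAnalytic_analyticLogv (F := T.K)) M archPk archSub Ψ act Mmod region n
          lat sig split qData (exists_realising_qIdeles_pilotDataOfK T.D).choose (exists_realising_thetaIdeles_pilotDataOfK T.D).choose
          (exists_realising_qIdeles_pilotDataOfK T.D).choose_spec.1 (exists_realising_qIdeles_pilotDataOfK T.D).choose_spec.2.1)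
        (fun _ => Cor312.Setting.qRegion
          (settingPrVolSharp (pilotDataOfK T.D T.K) (logvAnalytic_analyticLogv (F := T.K)) M archPk archSub Ψ act Mmod region n
            lat sig split qData (exists_realising_qIdeles_pilotDataOfK T.D).choose (exists_realising_thetaIdeles_pilotDataOfK T.D).choose
            (exists_realising_qIdeles_pilotDataOfK T.D).choose_spec.1 (exists_realising_qIdeles_pilotDataOfK T.D).choose_spec.2.1))
        qK := by
  have hcells := WildCells.frey99794037551104 l hl
  have hl3 : (3 : ℕ) ≠ l ∧ 3 ≤ l := by
    simp only [List.mem_cons, List.not_mem_nil, or_false] at hl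
    rcases hl with rfl; norm_num
  exact GenuineK.not_pilotKummerCompatHull_chosen_triple_of_wildCells (b := 3 ^ 15 * 11 ^ 3 * 97 ^ 5 * 409) isABCTriple_frey99794037551104 T ⟨3, by norm_num⟩ (p' := 5)
    (Or.inl ⟨rfl, rfl⟩) hl3.1 (t := 15) (by norm_num) (by norm_num) (by norm_num) (i := (l - 1) / 2 - 1) (by omega) hcells

end Summit.ABC.IUTFork.Conditional

end

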